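import Summits.QuantumFields.BalabanUV.Beta.HessKerDressedUnitsWall
import Literature.MathematicalPhysics.QuantumFieldTheory.Balaban1983to89.Beta.BalabanStepJetsSucc
import Literature.MathematicalPhysics.QuantumFieldTheory.King1986.CovarianceRate

/-!
# `BalabanUV.Beta.GAN24.CombesThomas` — binder row G-an2-4 / (CONV-C), propagator slot, road P1 (Combes–Thomas / resolvent
# expansion): the LEAN STATEMENT of the one-step η-rate comparison for the unit-normalised step resolvents `D_j · KInvStep Lc j · D_j`,
# and the KERNEL-PROVED REDUCTION «the rate needs no off-diagonal input beyond the uniform decay»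

NOT IN PRINT; OUR PROOF ATTEMPT.  HONEST FRAMING (cell contract, verbatim): «discharging `BetaPertH` makes Bałaban's UV stability
UNCONDITIONAL — a real constructive-QFT result; it is NOT the continuum limit and NOT the Clay problem.»  HONEST DEPENDENCY (verbatim):
«continuum YM on T⁴ ⇐ BetaPertH ∧ nine spine estimates (0/9 proved); BetaPertH ⇐ (D1) ∧ (D4) ∧ CAP+tail; G-an2-4 gates asym, D1 and
NE2/3/4.»  This module STATES the K-slot of (CONV-C) as named predicates over the cell's typed objects and PROVES, from explicit hypotheses
only, how the wall's propagator binders follow from a weaker-looking pair; it instantiates NO wall binder, discharges NOTHING of (CONV-C) and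
mints no cited fact (ABSOLUTE RULE; `[folklore]` = elementary real analysis / finite sums).  NOT summit progress.

## The target, typed.  With `K_j := KInvStep Lc j` (an2's decimated composite resolvent of the genuine step-`j` system at `U = 1`,
`Beta/OneStepKernelFamily`) and leg units `D_j = diag(s_f j on field legs ∣ s_m j on multiplier legs)` (`HessKerDressedUnits.unitK`; adopted
instance `s_f j = Lc^j`, `s_m j = Lc^{j(d+1)}`, GAPS Q-asym1-8 — PROVISIONAL in `BalabanStepJetsSucc`'s UNITS paragraph, hence kept as
PARAMETERS below), the wall END `HessKerDressedUnitsWall.d1Drift_JsBalOf_iff_of_cauchy_unit` consumes, for the propagator, EXACTLY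
  (hK)    `∀ j, Decays (D_j K_j D_j) C δK`                                              — `UnitDecayK d Lc s_f s_m C δK`,
  (hKall) `∀ k j, Decays (D_{k+j} K_{k+j} D_{k+j} − D_k K_k D_k) (cK θ^k) δK`, `0 ≤ θ < 1`  — `CauchyDecayK d Lc s_f s_m cK θ δK`:
a `j`-UNIFORM exponential decay on the step-`j` unit lattice AND a geometric Cauchy rate IN THE SAME EXPONENTIALLY WEIGHTED NORM.  (hK) is of
the TYPE Bałaban prints for his torus operators ([Balaban1984PropagatorsI] Prop. 1.2 pp. 35–36 «δ₀ depending on d only»;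
[Balaban1984PropagatorsII] Prop. 2.5 p. 246 «(or on the whole lattice ξZ^d)») — CONTEXT ONLY: the typed `K_j` is the cell's own `ℤ^{d+1}`
Bloch-fibre object, no dictionary to the printed operators is proved, nothing printed is used; in the tree (hK) holds PER `j` only
(`OneStepKernelFamily.decays_KInvStep`, constants from compactness in `FibreInverseDecay.exists_stripRegular_inv`).  (hKall) is the
UNPRINTED scale-to-scale rate ([Balaban1987RG1] p. 264 defers the `k`-uniform perturbative analysis to a paper that did not appear; GAPS
G-an2-4; presearch corpus + galaxy: nothing beyond the scalar / abelian precedents Gawędzki–Kupiainen 1981 and King 1986 Lemma 4.5).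

## What is PROVED (0 sorry; constants explicit)
§1 (generic matrix-fibred kernels on `ℤ^D`): `SupBound A ε`; the INTERPOLATION STEP `decays_half_of_decays_supBound`
(`Decays A C δ ∧ SupBound A ε ⇒ Decays A √(εC) (δ/2)`, `min ≤ geometric mean` — the mechanism of [King1986] (4.38)–(4.41), tree
`King1986.abs_le_sqrt_mul_exp_half` BY NAME); the currencies `UniformDecays`, `SupRate` (one-step sup-norm rate `c θ^j`), `SupCauchy`,
`DecayCauchy` (the wall's shape); `supCauchy_of_supRate` (telescoping + geometric series, `c/(1−θ)`);
**`decayCauchy_of_uniformDecays_supRate`**: `UniformDecays K C δ ∧ SupRate K c θ ∧ 0 ≤ θ < 1 ⇒ DecayCauchy K √(2(c/(1−θ))C) √θ (δ/2)`;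
the converse `supCauchy_of_decayCauchy` — {(hK),(hKall)} and {(hK), sup-norm rate} are the SAME information up to `(θ,δ) ↦ (√θ, δ/2)`.
§2 (the resolvent road, [King1986] (4.39)–(4.41) in `MKer` currency): `decays_comp3`; **`stepDecay_of_resolventRoad`** (resolvent identity
`K_{j+1} − K_j = K_{j+1} ∘ E_j ∘ K_j` as HYPOTHESIS + uniform decay + `Decays (E j) (ε θ^j) δ` ⇒ one-step difference with small constant at
rate `δ/4`); `decayCauchy_of_stepDecay`; `stepDecay_of_uniformDecays_supRate` (the increments' rate from a sup-norm rate).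
§3 (the step family): `UnitDecayK`, `SupRateK`, `CauchyDecayK` in arbitrary units; `cauchyDecayK_of_unitDecayK_supRateK`; the adopted units
`sfStep`, `smStep`, `KStepUnit`; **`ConvCK d Lc`** (road-P1 form: uniform decay + sup rate) `↔` **`ConvCKWall d Lc`** (the wall's form).
§4 (`d = 3`): **`d1Drift_JsBalOf_iff_of_unitDecayK_supRateK`** (any units) / `…_step` (adopted units): an2's END with its propagator binders
REPLACED by `(UnitDecayK, SupRateK)` — the kernel certificate that §3's predicates are the wall's currency.  Nothing is instantiated.

## LOCATED GAP CENSUS for road P1 (inputs of a PROOF of `ConvCK d Lc`; tree status 2026-08-19; none in print AS TYPED)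
(I3) = (hK) `UnitDecayK`: a `j`-uniform analyticity strip, with `j`-uniform bound, of the inverse Bloch fibre matrix of the typed KKT system in
     unit-normalised legs (⇔ `j`-uniform coercivity of the step-`j` effective KKT form + Combes–Thomas in the quadratic-form version of
     `Beta/CombesThomasFormOp`).  Tree: per-`N` only (`decays_KInv`); `η`-uniform Combes–Thomas decay exists for the SCALAR toy
     `(−Δ^η + aQ*Q)⁻¹` (`Beta/TorusG0Decay.setDecay_torus`, `Beta/EffectiveKernel.Keff_entry_bound`) and, modulo the printed leaf (1.126),
     for the vector `Δ_a` (`Beta/DeltaACombesThomas`) — NOT for `KInv`/`KInvStep`.  Missing input, typed: `∃ C δ, 0 < δ ∧ UnitDecayK d Lc s_f s_m C δ`.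
(I2) `SupRateK` (road P1a) or the sup-rate of the effective-form increments `E_j` (road P1b): an `O(Lc^{−2j})` bound on Bloch-fibre SYMBOLS
     at REAL momenta (King's Lemma 4.3 type; tree `King1986.CompositionLaw.lemma43_aK`, scalar averaging symbol only).  Missing input,
     typed: `∃ c θ, 0 ≤ θ < 1 ∧ SupRateK d Lc s_f s_m c θ`.
(R)  (road P1b only) the resolvent identity `hres`: identification of the `dec`-marginal `KInvStep Lc j` with the inverse of the step-`j`
     bordered effective operator («NOT here» list of `Beta/OneStepKernelFamily`, part of `D1Tel`).
ANSWER to «which off-diagonal decay/uniformity input is missing»: ONLY the uniform decay (I3) itself; by §1 the RATE input (I2) is a pure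
sup-norm statement.  Records: `HOME/b2b-balaban-gan24-p1/STATUS.md`, `HOME/BETA/GAN24-NAMES.md` § gan24-p1, GAPS row G-an2-4.
-/

open Finset
open scoped BigOperators
open Literature.MathematicalPhysics.QuantumFieldTheory
open Literature.MathematicalPhysics.QuantumFieldTheory.Balaban1983to89
open Literature.MathematicalPhysics.QuantumFieldTheory.Balaban1983to89.Beta
open B12Sec2to5 (l1 l1_nonneg)
open ExpKernelCalculus (MKer Decays VertexFamily₂ hessKer comp Zl Zl_nonneg)
open HessKerRate (decays_sub)
open OneStepResolventKernel (Fib LocStencil)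
open OneStepKernelFamily (KInvStep D1Drift)
open AxialDressing (axDressK axVertexOfK)
open BalabanStepJetsSucc (JsBal0Of JsBalOf)
open HessKerDressedLimit (limMKerOf limStOf limTabOf mker_sub_apply)
open Summit.QuantumFields.BalabanUV.Beta.HessKerDressedUnits (unitK unitS unitW)
open Summit.QuantumFields.BalabanUV.Beta.HessKerDressedUnitsWall (d1Drift_JsBalOf_iff_of_cauchy_unit)

namespace Summit.QuantumFields.BalabanUV.Beta.GAN24.CombesThomas

/-! ## §1 Generic: sup-norm bounds, the interpolation step, and the three rate currencies -/

section Generic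

variable {D : ℕ} {F : Type*}

/-- [folklore] A pure SUP-NORM bound on a matrix-fibred lattice kernel: `|A x y a b| ≤ ε` (no decay asked). -/
def SupBound (A : MKer D F) (ε : ℝ) : Prop := ∀ x y a b, |A x y a b| ≤ ε

/-- [folklore] The sup bound is nonnegative once the fibre is inhabited. -/
theorem SupBound.nonneg {A : MKer D F} {ε : ℝ} (h : SupBound A ε) (a : F) : 0 ≤ ε :=
  (abs_nonneg _).trans (h 0 0 a a)

/-- [folklore] A decaying kernel with nonnegative rate is sup-bounded by its constant. -/
theorem supBound_of_decays {A : MKer D F} {C δ : ℝ} (h : Decays A C δ) (hδ : 0 ≤ δ) (a₀ : F) : SupBound A C := fun x y a b =>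
  (h x y a b).trans (mul_le_of_le_one_right (h.nonneg a₀) (Real.exp_le_one_iff.2 (by nlinarith [l1_nonneg (x - y)])))

/-- [folklore] **THE INTERPOLATION STEP** (`min ≤ geometric mean`; the mechanism of [King1986] (4.38)–(4.41), tree
`King1986.abs_le_sqrt_mul_exp_half` BY NAME): exponential decay with constant `C` at rate `δ` and a sup-norm bound `ε`
give decay with the SMALL constant `√(εC)` at HALF the rate.  This is why a RATE in the exponentially weighted norm needs no
off-diagonal information beyond the uniform decay itself. -/
theorem decays_half_of_decays_supBound {A : MKer D F} {C δ ε : ℝ} (hA : Decays A C δ) (hε : 0 ≤ ε) (hsup : SupBound A ε) :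
    Decays A (Real.sqrt (ε * C)) (δ / 2) := by
  intro x y a b
  have h2 := hA x y a b
  rw [neg_mul] at h2
  have h := King1986.abs_le_sqrt_mul_exp_half hε (hsup x y a b) h2
  rwa [← neg_mul] at h

/-- [folklore] `j`-UNIFORM exponential decay of a kernel family (the wall's binder shape `hK`). -/
def UniformDecays (K : ℕ → MKer D F) (C δ : ℝ) : Prop := ∀ j, Decays (K j) C δ

/-- [folklore] ONE-STEP SUP-NORM RATE: `|K_{j+1} − K_j| ≤ c θ^j` entrywise, no decay asked. -/
def SupRate (K : ℕ → MKer D F) (c θ : ℝ) : Prop := ∀ j, SupBound (K (j + 1) - K j) (c * θ ^ j)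

/-- [folklore] SUP-NORM CAUCHY RATE: `|K_{k+j} − K_k| ≤ c θ^k` entrywise for all `j`. -/
def SupCauchy (K : ℕ → MKer D F) (c θ : ℝ) : Prop := ∀ k j, SupBound (K (k + j) - K k) (c * θ ^ k)

/-- [folklore] CAUCHY RATE IN THE EXPONENTIALLY WEIGHTED NORM (the wall's binder shape `hKall`):
`Decays (K_{k+j} − K_k) (cK θ^k) δ` for all `k, j`. -/
def DecayCauchy (K : ℕ → MKer D F) (cK θ δ : ℝ) : Prop := ∀ k j, Decays (K (k + j) - K k) (cK * θ ^ k) δ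

/-- [folklore] The constant of a one-step sup rate is nonnegative (inhabited fibre). -/
theorem SupRate.nonneg {K : ℕ → MKer D F} {c θ : ℝ} (h : SupRate K c θ) (a : F) : 0 ≤ c := by
  simpa only [pow_zero, mul_one] using (h 0).nonneg a

/-- [folklore] Entrywise telescoping of a kernel family: `(K_{k+j} − K_k)(x,y)_{ab} = Σ_{i<j} (K_{k+i+1} − K_{k+i})(x,y)_{ab}`. -/
theorem sub_apply_eq_sum_range (K : ℕ → MKer D F) (k j : ℕ) (x y : Fin D → ℤ) (a b : F) :
    (K (k + j) - K k) x y a b = ∑ i ∈ Finset.range j, (K (k + i + 1) - K (k + i)) x y a b := by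
  induction j with
  | zero => simp [mker_sub_apply]
  | succ j ih =>
      rw [Finset.sum_range_succ, ← ih]
      simp only [mker_sub_apply]
      rw [show k + (j + 1) = k + j + 1 from rfl]
      ring

/-- [folklore] **ONE-STEP ⇒ CAUCHY, sup-norm currency**: telescoping and the geometric series, constant `c/(1−θ)`. -/
theorem supCauchy_of_supRate {K : ℕ → MKer D F} {c θ : ℝ} (h : SupRate K c θ) (hc : 0 ≤ c) (hθ0 : 0 ≤ θ) (hθ1 : θ < 1) :
    SupCauchy K (c / (1 - θ)) θ := by
  intro k j x y a b
  rw [sub_apply_eq_sum_range]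
  have hgeom : ∑ i ∈ Finset.range j, θ ^ i ≤ (1 - θ)⁻¹ :=
    sum_le_hasSum (Finset.range j) (fun i _ => pow_nonneg hθ0 i) (hasSum_geometric_of_lt_one hθ0 hθ1)
  calc |∑ i ∈ Finset.range j, (K (k + i + 1) - K (k + i)) x y a b|
      ≤ ∑ i ∈ Finset.range j, |(K (k + i + 1) - K (k + i)) x y a b| := Finset.abs_sum_le_sum_abs _ _
    _ ≤ ∑ i ∈ Finset.range j, c * θ ^ (k + i) := Finset.sum_le_sum fun i _ => h (k + i) x y a b
    _ = c * θ ^ k * ∑ i ∈ Finset.range j, θ ^ i := by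
        rw [Finset.mul_sum]; exact Finset.sum_congr rfl fun i _ => by rw [pow_add]; ring
    _ ≤ c * θ ^ k * (1 - θ)⁻¹ := mul_le_mul_of_nonneg_left hgeom (mul_nonneg hc (pow_nonneg hθ0 k))
    _ = c / (1 - θ) * θ ^ k := by rw [div_eq_mul_inv]; ring

/-- [folklore] `√(θ^k) = (√θ)^k` for `θ ≥ 0`. -/
theorem sqrt_pow_eq {θ : ℝ} (hθ : 0 ≤ θ) (k : ℕ) : Real.sqrt (θ ^ k) = Real.sqrt θ ^ k := by
  rw [← Real.sqrt_sq (pow_nonneg (Real.sqrt_nonneg θ) k)]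
  congr 1
  rw [← pow_mul, mul_comm, pow_mul, Real.sq_sqrt hθ]

/-- [folklore] **UNIFORM DECAY + SUP-NORM CAUCHY RATE ⇒ THE WALL'S CAUCHY RATE** (rate `√θ`, decay `δ/2`, constant `√(2cC)`). -/
theorem decayCauchy_of_uniformDecays_supCauchy {K : ℕ → MKer D F} {C δ c θ : ℝ} (hK : UniformDecays K C δ)
    (hS : SupCauchy K c θ) (hc : 0 ≤ c) (hθ : 0 ≤ θ) :
    DecayCauchy K (Real.sqrt (2 * c * C)) (Real.sqrt θ) (δ / 2) := by
  intro k j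
  have hdec : Decays (K (k + j) - K k) (C + C) δ := decays_sub (hK (k + j)) (hK k)
  have h := decays_half_of_decays_supBound hdec (mul_nonneg hc (pow_nonneg hθ k)) (hS k j)
  have e : Real.sqrt (c * θ ^ k * (C + C)) = Real.sqrt (2 * c * C) * Real.sqrt θ ^ k := by
    rw [show c * θ ^ k * (C + C) = (2 * c * C) * θ ^ k by ring, Real.sqrt_mul' _ (pow_nonneg hθ k), sqrt_pow_eq hθ]
  rw [e] at h
  exact h

/-- [folklore] **UNIFORM DECAY + ONE-STEP SUP-NORM RATE ⇒ THE WALL'S CAUCHY RATE** (`0 ≤ θ < 1`; rate `√θ`, decay `δ/2`,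
constant `√(2(c/(1−θ))C)`).  The K-slot reduction of road P1. -/
theorem decayCauchy_of_uniformDecays_supRate {K : ℕ → MKer D F} {C δ c θ : ℝ} (hK : UniformDecays K C δ) (hS : SupRate K c θ)
    (hc : 0 ≤ c) (hθ0 : 0 ≤ θ) (hθ1 : θ < 1) :
    DecayCauchy K (Real.sqrt (2 * (c / (1 - θ)) * C)) (Real.sqrt θ) (δ / 2) :=
  decayCauchy_of_uniformDecays_supCauchy hK (supCauchy_of_supRate hS hc hθ0 hθ1) (div_nonneg hc (by linarith)) hθ0

/-- [folklore] CONVERSE: a Cauchy rate in the weighted norm (`δ ≥ 0`) is in particular a sup-norm Cauchy rate — so the wall's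
K-binders `{hK, hKall}` and `{hK, SupCauchy}` carry the same information up to `(θ, δ) ↦ (√θ, δ/2)`. -/
theorem supCauchy_of_decayCauchy {K : ℕ → MKer D F} {cK θ δ : ℝ} (h : DecayCauchy K cK θ δ) (hδ : 0 ≤ δ) (a₀ : F) :
    SupCauchy K cK θ :=
  fun k j => supBound_of_decays (h k j) hδ a₀

/-- [folklore] A one-step sup rate from a sup-norm Cauchy rate (`j = 1`). -/
theorem supRate_of_supCauchy {K : ℕ → MKer D F} {c θ : ℝ} (h : SupCauchy K c θ) : SupRate K c θ :=
  fun j => h j 1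

/-- [folklore] The rate `√θ` is again in `[0, 1)`. -/
theorem sqrt_rate_lt_one {θ : ℝ} (hθ1 : θ < 1) : Real.sqrt θ < 1 :=
  (Real.sqrt_lt' one_pos).2 (by rwa [one_pow])

end Generic

/-! ## §2 The resolvent road ([King1986] Lemma 4.5, (4.39)–(4.41)) in `MKer` currency -/

section Resolvent

variable {D : ℕ} {F : Type*} [Fintype F]

omit [Fintype F] in
/-- [folklore] Rate monotonicity of `Decays` (dimension-generic twin of `OneStepResolventKernel.decays_mono`). -/
theorem decays_of_le_rate {A : MKer D F} {C δ δ' : ℝ} (h : Decays A C δ) (hC : 0 ≤ C) (hδ : δ' ≤ δ) : Decays A C δ' :=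
  fun x y a b => OneStepResolventKernel.bound_mono (h x y a b) hC le_rfl hδ (l1_nonneg _)

/-- [folklore] **DECAYING ∘ DECAYING ∘ DECAYING DECAYS** (rate `δ/4`, explicit constant; two applications of an2's
`BalabanStepJetsSucc.decays_comp`).  The shape of (4.41): outer resolvents × decaying increment. -/
theorem decays_comp3 {A E B : MKer D F} {CA CE CB δ : ℝ} (hA : Decays A CA δ) (hE : Decays E CE δ) (hB : Decays B CB δ)
    (hCB : 0 ≤ CB) (hδ : 0 < δ) :
    Decays (comp (comp A E) B)
      ((Fintype.card F : ℝ) * ((Fintype.card F : ℝ) * (CA * CE) * Zl D (δ - δ / 2) * CB) * Zl D (δ / 2 - δ / 4)) (δ / 4) := by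
  have hAE := BalabanStepJetsSucc.decays_comp hA hE (by linarith : (0 : ℝ) ≤ δ / 2) (by linarith : δ / 2 < δ)
  have hB' : Decays B CB (δ / 2) := decays_of_le_rate hB hCB (by linarith)
  exact BalabanStepJetsSucc.decays_comp hAE hB' (by linarith : (0 : ℝ) ≤ δ / 4) (by linarith : δ / 4 < δ / 2)

/-- [folklore] **THE RESOLVENT ROAD, ONE STEP**: a resolvent identity `K_{j+1} − K_j = K_{j+1} ∘ E_j ∘ K_j` (HYPOTHESIS — for the
typed step resolvents it is input (R) of the census), `j`-uniform decay of `K` and increments `E_j` decaying with the SMALL constant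
`ε θ^j` give the one-step difference the small constant `const · ε θ^j` at rate `δ/4` ([King1986] (4.40)–(4.41)). -/
theorem stepDecay_of_resolventRoad {K E : ℕ → MKer D F} {C ε δ θ : ℝ}
    (hres : ∀ j, K (j + 1) - K j = comp (comp (K (j + 1)) (E j)) (K j))
    (hK : UniformDecays K C δ) (hE : ∀ j, Decays (E j) (ε * θ ^ j) δ) (hC : 0 ≤ C) (hδ : 0 < δ) (j : ℕ) :
    Decays (K (j + 1) - K j)
      ((Fintype.card F : ℝ) * ((Fintype.card F : ℝ) * (C * C) * Zl D (δ - δ / 2)) * Zl D (δ / 2 - δ / 4) * ε * θ ^ j)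
      (δ / 4) := by
  have h := decays_comp3 (hK (j + 1)) (hE j) (hK j) hC hδ
  rw [hres j]
  intro x y a b
  refine (h x y a b).trans (le_of_eq ?_)
  ring

omit [Fintype F] in
/-- [folklore] **ONE-STEP ⇒ CAUCHY, weighted currency**: `Decays (K_{j+1} − K_j) (c θ^j) δ` for all `j` and `0 ≤ θ < 1` give
`DecayCauchy K (c/(1−θ)) θ δ` (telescoping entrywise, the weight `e^{−δ|x−y|₁}` factors out of the geometric series). -/
theorem decayCauchy_of_stepDecay {K : ℕ → MKer D F} {c θ δ : ℝ} (h : ∀ j, Decays (K (j + 1) - K j) (c * θ ^ j) δ)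
    (hc : 0 ≤ c) (hθ0 : 0 ≤ θ) (hθ1 : θ < 1) : DecayCauchy K (c / (1 - θ)) θ δ := by
  intro k j x y a b
  rw [sub_apply_eq_sum_range]
  have hgeom : ∑ i ∈ Finset.range j, θ ^ i ≤ (1 - θ)⁻¹ :=
    sum_le_hasSum (Finset.range j) (fun i _ => pow_nonneg hθ0 i) (hasSum_geometric_of_lt_one hθ0 hθ1)
  have hw : 0 ≤ Real.exp (-δ * l1 (x - y)) := (Real.exp_pos _).le
  calc |∑ i ∈ Finset.range j, (K (k + i + 1) - K (k + i)) x y a b|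
      ≤ ∑ i ∈ Finset.range j, |(K (k + i + 1) - K (k + i)) x y a b| := Finset.abs_sum_le_sum_abs _ _
    _ ≤ ∑ i ∈ Finset.range j, c * θ ^ (k + i) * Real.exp (-δ * l1 (x - y)) :=
        Finset.sum_le_sum fun i _ => h (k + i) x y a b
    _ = c * θ ^ k * Real.exp (-δ * l1 (x - y)) * ∑ i ∈ Finset.range j, θ ^ i := by
        rw [Finset.mul_sum]; exact Finset.sum_congr rfl fun i _ => by rw [pow_add]; ring
    _ ≤ c * θ ^ k * Real.exp (-δ * l1 (x - y)) * (1 - θ)⁻¹ :=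
        mul_le_mul_of_nonneg_left hgeom (mul_nonneg (mul_nonneg hc (pow_nonneg hθ0 k)) hw)
    _ = c / (1 - θ) * θ ^ k * Real.exp (-δ * l1 (x - y)) := by rw [div_eq_mul_inv]; ring

omit [Fintype F] in
/-- [folklore] The increments' own rate by §1: a `j`-uniformly decaying family `B` (e.g. the step effective forms, padded to the fibre)
with a one-step SUP-norm rate `ε θ^j` has one-step differences decaying with the small constant `√(2εC)(√θ)^j` at rate `δ/2` — the
typed form of «Lemma 4.3 (symbols) + uniform decay ⇒ (4.41)'s middle factor». -/
theorem stepDecay_of_uniformDecays_supRate {B : ℕ → MKer D F} {C δ ε θ : ℝ} (hB : UniformDecays B C δ) (hS : SupRate B ε θ)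
    (hε : 0 ≤ ε) (hθ : 0 ≤ θ) (j : ℕ) :
    Decays (B (j + 1) - B j) (Real.sqrt (2 * ε * C) * Real.sqrt θ ^ j) (δ / 2) := by
  have hdec : Decays (B (j + 1) - B j) (C + C) δ := decays_sub (hB (j + 1)) (hB j)
  have h := decays_half_of_decays_supBound hdec (mul_nonneg hε (pow_nonneg hθ j)) (hS j)
  have e : Real.sqrt (ε * θ ^ j * (C + C)) = Real.sqrt (2 * ε * C) * Real.sqrt θ ^ j := by
    rw [show ε * θ ^ j * (C + C) = (2 * ε * C) * θ ^ j by ring, Real.sqrt_mul' _ (pow_nonneg hθ j), sqrt_pow_eq hθ]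
  rw [e] at h
  exact h

end Resolvent

/-! ## §3 The unit-normalised step resolvents and the K-slot predicates of (CONV-C) -/

section StepUnits

variable {d : ℕ}

/-- (CONV-C)_K (a) IN LEG UNITS `(s_f, s_m)` — `j`-UNIFORM EXPONENTIAL DECAY of the rescaled step resolvents `D_j · KInvStep Lc j · D_j`,
`D_j = diag(s_f j ∣ s_m j)` (the wall's `hK`; printed TYPE, unproved for the typed object; census (I3)).  Exponent-agnostic: the unit
sequences are parameters.  A predicate, never a fact. -/
def UnitDecayK (d Lc : ℕ) [NeZero Lc] (sf sm : ℕ → ℝ) (C δ : ℝ) : Prop :=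
  UniformDecays (fun j => unitK (sf j) (sm j) (KInvStep (d := d) Lc j)) C δ

/-- (CONV-C)_K (b) IN LEG UNITS `(s_f, s_m)` — ONE-STEP SUP-NORM η-RATE of the rescaled step resolvents:
`|D_{j+1}K_{j+1}D_{j+1} − D_jK_jD_j| ≤ c θ^j` entrywise, no decay asked (NOT IN PRINT; expected `θ = Lc^{−2}`; census (I2)).
A predicate, never a fact. -/
def SupRateK (d Lc : ℕ) [NeZero Lc] (sf sm : ℕ → ℝ) (c θ : ℝ) : Prop :=
  SupRate (fun j => unitK (sf j) (sm j) (KInvStep (d := d) Lc j)) c θ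

/-- The wall's `hKall` IN LEG UNITS `(s_f, s_m)`: `Decays (D_{k+j}K_{k+j}D_{k+j} − D_kK_kD_k) (cK θ^k) δ`.  A predicate, never a fact. -/
def CauchyDecayK (d Lc : ℕ) [NeZero Lc] (sf sm : ℕ → ℝ) (cK θ δ : ℝ) : Prop :=
  DecayCauchy (fun j => unitK (sf j) (sm j) (KInvStep (d := d) Lc j)) cK θ δ

/-- [folklore] FIELD-leg unit of step `j` of the ADOPTED instance: `s_f = Lc^j` (GAPS Q-asym1-8; `BalabanStepJetsSucc` UNITS paragraph,
PROVISIONAL there — which is why the predicates above keep the units as parameters). -/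
def sfStep (Lc j : ℕ) : ℝ := (Lc : ℝ) ^ j

/-- [folklore] MULTIPLIER-leg unit of step `j` of the adopted instance: `s_m = Lc^{j(d+1)}`. -/
def smStep (d Lc j : ℕ) : ℝ := (Lc : ℝ) ^ (j * (d + 1))

/-- [folklore] `s_f ≠ 0`. -/
theorem sfStep_ne_zero {Lc : ℕ} [NeZero Lc] (j : ℕ) : sfStep Lc j ≠ 0 :=
  pow_ne_zero _ (Nat.cast_ne_zero.2 (NeZero.ne Lc))

/-- [folklore] `s_m ≠ 0`. -/
theorem smStep_ne_zero {Lc : ℕ} [NeZero Lc] (j : ℕ) : smStep d Lc j ≠ 0 :=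
  pow_ne_zero _ (Nat.cast_ne_zero.2 (NeZero.ne Lc))

/-- [folklore] **THE UNIT-NORMALISED STEP RESOLVENT** `K_j⁽¹⁾ := D_j · KInvStep Lc j · D_j`, `D_j = diag(Lc^j ∣ Lc^{j(d+1)})` — an2's
decimated composite resolvent of the step-`j` system at `U = 1` read in step-`j` lattice units (the object (CONV-C)'s K-slot is about). -/
noncomputable abbrev KStepUnit (Lc : ℕ) [NeZero Lc] (j : ℕ) : MKer (d + 1) (Fib d) :=
  unitK (sfStep Lc j) (smStep d Lc j) (KInvStep (d := d) Lc j)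

/-- **G-an2-4 / (CONV-C), PROPAGATOR SLOT, ROAD-P1 FORM** (adopted units `(Lc^j, Lc^{j(d+1)})`): uniform decay + one-step sup-norm rate
with `0 ≤ θ < 1`.  NOT IN PRINT; our proof target; asserted nowhere. -/
def ConvCK (d Lc : ℕ) [NeZero Lc] : Prop :=
  ∃ C δ c θ : ℝ, 0 < δ ∧ 0 ≤ θ ∧ θ < 1 ∧ UnitDecayK d Lc (sfStep Lc) (smStep d Lc) C δ ∧ SupRateK d Lc (sfStep Lc) (smStep d Lc) c θ

/-- **G-an2-4 / (CONV-C), PROPAGATOR SLOT, WALL FORM** (adopted units): the binder pair `(hK, hKall)` of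
`d1Drift_JsBalOf_iff_of_cauchy_unit`, existentially packaged.  Asserted nowhere. -/
def ConvCKWall (d Lc : ℕ) [NeZero Lc] : Prop :=
  ∃ C δ cK θ : ℝ, 0 < δ ∧ 0 ≤ θ ∧ θ < 1 ∧ UnitDecayK d Lc (sfStep Lc) (smStep d Lc) C δ ∧
    CauchyDecayK d Lc (sfStep Lc) (smStep d Lc) cK θ δ

variable {Lc : ℕ} [NeZero Lc] {sf sm : ℕ → ℝ}

/-- [folklore] The reduction at the step family, any units: `UnitDecayK ∧ SupRateK ∧ 0 ≤ θ < 1 ⇒ CauchyDecayK` (rate `√θ`, decay `δ/2`,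
constant `√(2(c/(1−θ))C)`). -/
theorem cauchyDecayK_of_unitDecayK_supRateK {C δ c θ : ℝ} (hK : UnitDecayK d Lc sf sm C δ) (hS : SupRateK d Lc sf sm c θ)
    (hθ0 : 0 ≤ θ) (hθ1 : θ < 1) :
    CauchyDecayK d Lc sf sm (Real.sqrt (2 * (c / (1 - θ)) * C)) (Real.sqrt θ) (δ / 2) :=
  decayCauchy_of_uniformDecays_supRate hK hS (SupRate.nonneg hS (Sum.inl 0)) hθ0 hθ1

/-- [folklore] The decay half at the halved rate (so that `hK` and the reduced `hKall` share the rate `δ/2`). -/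
theorem unitDecayK_half {C δ : ℝ} (hK : UnitDecayK d Lc sf sm C δ) (hδ : 0 ≤ δ) : UnitDecayK d Lc sf sm C (δ / 2) :=
  fun j => decays_of_le_rate (hK j) ((hK 0).nonneg (Sum.inl 0)) (by linarith)

/-- [folklore] **ROAD P1 ⇒ WALL**: `ConvCK d Lc → ConvCKWall d Lc`. -/
theorem convCKWall_of_convCK (h : ConvCK d Lc) : ConvCKWall d Lc := by
  obtain ⟨C, δ, c, θ, hδ, hθ0, hθ1, hK, hS⟩ := h
  exact ⟨C, δ / 2, Real.sqrt (2 * (c / (1 - θ)) * C), Real.sqrt θ, by linarith, Real.sqrt_nonneg θ, sqrt_rate_lt_one hθ1,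
    unitDecayK_half hK hδ.le, cauchyDecayK_of_unitDecayK_supRateK hK hS hθ0 hθ1⟩

/-- [folklore] **WALL ⇒ ROAD P1**: `ConvCKWall d Lc → ConvCK d Lc` (the weight `e^{−δ|·|₁} ≤ 1`). -/
theorem convCK_of_convCKWall (h : ConvCKWall d Lc) : ConvCK d Lc := by
  obtain ⟨C, δ, cK, θ, hδ, hθ0, hθ1, hK, hKall⟩ := h
  exact ⟨C, δ, cK, θ, hδ, hθ0, hθ1, hK, supRate_of_supCauchy (supCauchy_of_decayCauchy hKall hδ.le (Sum.inl 0))⟩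

/-- [folklore] **THE TWO CURRENCIES OF THE K-SLOT ARE EQUIVALENT**: `ConvCK d Lc ↔ ConvCKWall d Lc`. -/
theorem convCK_iff_convCKWall : ConvCK d Lc ↔ ConvCKWall d Lc := ⟨convCKWall_of_convCK, convCK_of_convCKWall⟩

end StepUnits

/-! ## §4 Dimension four: the wall END with the propagator binders replaced by `(UnitDecayK, SupRateK)` -/

section Wall

variable {Lc : ℕ} [NeZero Lc] (hLc : 1 ≤ Lc) (cE cVH cΛ : ℝ)
  (W : ℕ → Fin (3 + 1) → (Fin (3 + 1) → ℤ) → Fin (3 + 1) → (Fin (3 + 1) → ℤ) → MKer (3 + 1) (Fib 3))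
  (Cw' δw : ℕ → ℝ) (hδw : ∀ j, 0 < δw j) (hW' : ∀ j, VertexFamily₂ (W j) Lc (Cw' j) (δw j))
  (sf sm : ℕ → ℝ) {R C δK c θ Cs cS δS Cw cW δW : ℝ}

/-- [folklore] **THE WALL ⟺ THE EXPLICIT IDENTIFICATION, WITH THE PROPAGATOR BINDERS IN ROAD-P1 FORM, ANY LEG UNITS**: an2's
`HessKerDressedUnitsWall.d1Drift_JsBalOf_iff_of_cauchy_unit`, its `(hK, hKall)` supplied from `UnitDecayK 3 Lc sf sm C δK` and
`SupRateK 3 Lc sf sm c θ` by §3 (propagator rate `√θ`, decay `δK/2`, hence the window `R < δK/2`); the stencil and second-order binders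
are an2's, untouched, asked at the common rate `√θ`.  NOTHING is instantiated: every binder remains a hypothesis. -/
theorem d1Drift_JsBalOf_iff_of_unitDecayK_supRateK (hsf : ∀ j, sf j ≠ 0) (hsm : ∀ j, sm j ≠ 0)
    (hKu : UnitDecayK 3 Lc sf sm C δK) (hKr : SupRateK 3 Lc sf sm c θ)
    (hS : ∀ j, LocStencil (unitS (sf j) (sm j) (JsBal0Of hLc cE cVH cΛ W Cw' δw hδw hW' j).S) Cs δS)
    (hSall : ∀ k j, LocStencil (unitS (sf (k + j)) (sm (k + j)) (JsBal0Of hLc cE cVH cΛ W Cw' δw hδw hW' (k + j)).S -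
      unitS (sf k) (sm k) (JsBal0Of hLc cE cVH cΛ W Cw' δw hδw hW' k).S) (cS * Real.sqrt θ ^ k) δS)
    (hW : ∀ j, VertexFamily₂ (unitW (sf j) (sm j) (W j)) Lc Cw δW)
    (hWall : ∀ k j, VertexFamily₂ (unitW (sf (k + j)) (sm (k + j)) (W (k + j)) - unitW (sf k) (sm k) (W k)) Lc
      (cW * Real.sqrt θ ^ k) δW)
    (hR : 0 < R) (hRK : R < δK / 2) (hRS : R / 2 < δS) (hRW : R < δW) (hθ0 : 0 ≤ θ) (hθ1 : θ < 1) (μ ν : Fin 4) (N : ℝ) :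
    D1Drift Lc (JsBalOf hLc cE cVH cΛ W Cw' δw hδw hW') N μ ν ↔
      B12Beta.secondMoment (hessKer (axDressK Lc (limMKerOf fun j => unitK (sf j) (sm j) (KInvStep (d := 3) Lc j)))
        (axVertexOfK (limMKerOf fun j => unitK (sf j) (sm j) (KInvStep (d := 3) Lc j)) Lc
          (limStOf fun j => unitS (sf j) (sm j) (JsBal0Of hLc cE cVH cΛ W Cw' δw hδw hW' j).S))
        (limTabOf fun j => unitW (sf j) (sm j) (W j))) μ ν = B12Normalization.stepBal N Lc :=
  d1Drift_JsBalOf_iff_of_cauchy_unit hLc cE cVH cΛ W Cw' δw hδw hW' sf sm hsf hsm (unitDecayK_half hKu (by linarith))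
    (cauchyDecayK_of_unitDecayK_supRateK hKu hKr hθ0 hθ1) hS hSall hW hWall hR hRK hRS hRW (Real.sqrt_nonneg θ)
    (sqrt_rate_lt_one hθ1) μ ν N

/-- [folklore] The same at the ADOPTED units `(Lc^j, Lc^{4j})` (`sfStep`, `smStep 3`; nonvanishing discharged). -/
theorem d1Drift_JsBalOf_iff_of_unitDecayK_supRateK_step
    (hKu : UnitDecayK 3 Lc (sfStep Lc) (smStep 3 Lc) C δK) (hKr : SupRateK 3 Lc (sfStep Lc) (smStep 3 Lc) c θ)
    (hS : ∀ j, LocStencil (unitS (sfStep Lc j) (smStep 3 Lc j) (JsBal0Of hLc cE cVH cΛ W Cw' δw hδw hW' j).S) Cs δS)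
    (hSall : ∀ k j, LocStencil (unitS (sfStep Lc (k + j)) (smStep 3 Lc (k + j)) (JsBal0Of hLc cE cVH cΛ W Cw' δw hδw hW' (k + j)).S -
      unitS (sfStep Lc k) (smStep 3 Lc k) (JsBal0Of hLc cE cVH cΛ W Cw' δw hδw hW' k).S) (cS * Real.sqrt θ ^ k) δS)
    (hW : ∀ j, VertexFamily₂ (unitW (sfStep Lc j) (smStep 3 Lc j) (W j)) Lc Cw δW)
    (hWall : ∀ k j, VertexFamily₂ (unitW (sfStep Lc (k + j)) (smStep 3 Lc (k + j)) (W (k + j)) -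
      unitW (sfStep Lc k) (smStep 3 Lc k) (W k)) Lc (cW * Real.sqrt θ ^ k) δW)
    (hR : 0 < R) (hRK : R < δK / 2) (hRS : R / 2 < δS) (hRW : R < δW) (hθ0 : 0 ≤ θ) (hθ1 : θ < 1) (μ ν : Fin 4) (N : ℝ) :
    D1Drift Lc (JsBalOf hLc cE cVH cΛ W Cw' δw hδw hW') N μ ν ↔
      B12Beta.secondMoment (hessKer (axDressK Lc (limMKerOf fun j => KStepUnit (d := 3) Lc j))
        (axVertexOfK (limMKerOf fun j => KStepUnit (d := 3) Lc j) Lc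
          (limStOf fun j => unitS (sfStep Lc j) (smStep 3 Lc j) (JsBal0Of hLc cE cVH cΛ W Cw' δw hδw hW' j).S))
        (limTabOf fun j => unitW (sfStep Lc j) (smStep 3 Lc j) (W j))) μ ν = B12Normalization.stepBal N Lc :=
  d1Drift_JsBalOf_iff_of_unitDecayK_supRateK hLc cE cVH cΛ W Cw' δw hδw hW' (sfStep Lc) (smStep 3 Lc) sfStep_ne_zero smStep_ne_zero
    hKu hKr hS hSall hW hWall hR hRK hRS hRW hθ0 hθ1 μ ν N

end Wall

end Summit.QuantumFields.BalabanUV.Beta.GAN24.CombesThomas
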